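/-
Copyright (c) 2026. All rights reserved.
Released under Apache 2.0 license as described in the file LICENSE.
-/
import Summits.Langlands.Langlands.Theorems.SoloInformedTrivialRepTensorInvariants
import Summits.Langlands.Langlands.Theorems.SoloInformedBmaxInvariantsInField
import Literature.NumberTheory.GaloisRepresentations.PadicAlgebraIntegral
import Literature.NumberTheory.PAdicHodge.PadicBaseField
import HarnessLib

/-!
# `m·f ≤ dim D_cris(𝟙_m) ≤ m·[F:ℚ_p]`, finiteness unconditional (solo programme, rung Λ8b)

Programme `solo-Langlands-informed`, repair of the crystalline clause D2-cris of `Summit.Langlands`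
(`SpecC` = the comparison `B_max(F)^{Γ_F} = K₀`).  The clause `CrystallineCompatibleAt`
(`Theorems/SoloInformedRepairD2Cris`) predicts `dim_{ℚ̄_p} D_cris(𝟙_m) = m · f(F|ℚ_p)` for the trivial local
representation; the tree had the lower bound `m · f ≤ dim` under an ASSUMED finiteness instance
(`D2Cris.mul_le_finrank_Dcris_one`).  With rung Λ4 (`SpecC.invariantToField : B_max(F)^{Γ_F} ↪ F`, de Rham
comparison) and rung Λ8a (`D2Cris.finrank_Dcris_one_eq : dim D_cris(𝟙_m) = m · dim_{ℚ_p} B_max(F)^{Γ_F}`) this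
file makes the finiteness UNCONDITIONAL and sandwiches the dimension:

* §1 `invariantHom` ★ : the injective ring homomorphism **`B_max(F)^{Γ_F} →+* F`** packaging Λ4, and
  `invariantAlgHom` : it is a **`ℚ_p`-algebra map** for the canonical `ℚ_p`-structure of `F` — for free, by the
  rigidity of `ℚ_p` (tree `LocalField.ringHom_padic_ext`: any two ring maps `ℚ_p → F` agree);
* §2 `finite_fixedSubalgebra` ★ : **`B_max(F)^{Γ_F}` is finite-dimensional over `ℚ_p`**, with
  `le_finrank_fixedSubalgebra_le` : **`f ≤ dim_{ℚ_p} B_max(F)^{Γ_F} ≤ [F : ℚ_p]`** (`[F : ℚ_p] < ∞`: tree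
  `PadicBase.instFiniteDimensional`);
* §3 ★★ `finite_Dcris_one` : **`D_cris(𝟙_m)` is finite-dimensional over `ℚ̄_p`, for every `p`-adic field `F`**
  (only `θ` surjective); `mul_le_finrank_Dcris_one_le` : **`m · f ≤ dim_{ℚ̄_p} D_cris(𝟙_m) ≤ m · [F : ℚ_p]`**;
  and `finrank_Dcris_one_eq_of_finrank_eq` : **`dim D_cris(𝟙_m) = m · f`** under the single binder
  `[F : ℚ_p] = f` — which for absolutely unramified `F` IS the degree formula `[F : ℚ_p] = e · f` (`e = 1`), not yet
  in the tree in this currency; it is the only input between the tree and the input-free `𝟙_m` instance of the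
  rank clause of `CrystallineCompatibleAt` at unramified places.

References: Fontaine, Astérisque 223 (1994), Exp. III §1.5 (`dim_{K} D_B(V) ≤ dim V`), §4.1;
Colmez, Ann. of Math. 148 (1998), §III.2; Serre, *Local Fields* (1979), Ch. II §5; Buzzard–Gee, LMS LNS 414
(2014), Conj. 3.2.2.
-/

noncomputable section

open scoped MatrixGroups TensorProduct ValuativeRel
open WittVector Field IsLocalRing ValuativeRel
open Literature.NumberTheory.GaloisRepresentations Literature.NumberTheory.PAdicHodge
open Literature.NumberTheory.GaloisRepresentations.IsNonarchimedeanLocalField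

namespace Summit.Langlands.Langlands.Theorems

namespace SpecC

variable {F : Type} [Field F] [ValuativeRel F] [TopologicalSpace F] [IsNonarchimedeanLocalField F] [CharZero F]
  {p : ℕ} [Fact p.Prime] [Fact (¬ IsUnit (p : integerC F))] [IsAdicComplete (Ideal.span {(p : integerC F)}) (integerC F)]

/-! ### §1 The ring homomorphism `B_max(F)^{Γ_F} → F` and its `ℚ_p`-linearity -/

section Hom

variable (hp : valuation F p < 1) (hF : Function.Surjective (fontaineTheta (integerC F) p))

/-- An element of `B_max(F)^{Γ_F}` (`fixedSubalgebra galBmaxAlgHom`) is `Γ_F`-invariant (`galBmaxAlgHom σ = galBmax σ`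
on elements). [folklore] -/
theorem forall_galBmax_coe (w : D2Cris.fixedSubalgebra (D2Cris.galBmaxAlgHom (F := F) (p := p)))
    (σ : absoluteGaloisGroup F) : D2Cris.galBmax σ (w : D2Cris.Bmax F p) = w :=
  w.2 σ

/-- The underlying function of `invariantHom`: `w ↦` the unique `c ∈ F` with the same image as `w` in `B_dR(F)`
(rung Λ4 `invariantToField`). [cite: FontaineAsterisque223III, Exp. III §4.1] -/
def invariantFun (w : D2Cris.fixedSubalgebra (D2Cris.galBmaxAlgHom (F := F) (p := p))) : F :=
  invariantToField hp hF (forall_galBmax_coe w)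

/-- Defining property: `embBdR (invariantFun w) = w` in `B_dR(F)`. [folklore] -/
theorem algebraMap_embBdRHom_invariantFun (w : D2Cris.fixedSubalgebra (D2Cris.galBmaxAlgHom (F := F) (p := p))) :
    algebraMap (BDeRhamPlus (integerC F) p) (FracBdR F p) (embBdRHom hp hF (invariantFun hp hF w)) =
      bmaxToFracBdR hF (w : D2Cris.Bmax F p) :=
  algebraMap_embBdRHom_invariantToField hp hF (forall_galBmax_coe w)

/-- Characterisation: `invariantFun w = c ↔ embBdR c = w` in `B_dR(F)`. [folklore] -/
theorem invariantFun_eq_iff (w : D2Cris.fixedSubalgebra (D2Cris.galBmaxAlgHom (F := F) (p := p))) (c : F) :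
    invariantFun hp hF w = c ↔
      algebraMap (BDeRhamPlus (integerC F) p) (FracBdR F p) (embBdRHom hp hF c) = bmaxToFracBdR hF (w : D2Cris.Bmax F p) :=
  invariantToField_eq_iff hp hF (forall_galBmax_coe w) c

/-- `invariantFun 1 = 1`. [folklore] -/
theorem invariantFun_one : invariantFun hp hF 1 = 1 := by
  rw [invariantFun_eq_iff, map_one, map_one, Subalgebra.coe_one, map_one]

/-- `invariantFun 0 = 0`. [folklore] -/
theorem invariantFun_zero : invariantFun hp hF 0 = 0 := by
  rw [invariantFun_eq_iff, map_zero, map_zero, Subalgebra.coe_zero, map_zero]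

/-- `invariantFun` is multiplicative. [folklore] -/
theorem invariantFun_mul (w w' : D2Cris.fixedSubalgebra (D2Cris.galBmaxAlgHom (F := F) (p := p))) :
    invariantFun hp hF (w * w') = invariantFun hp hF w * invariantFun hp hF w' := by
  rw [invariantFun_eq_iff, map_mul, map_mul, algebraMap_embBdRHom_invariantFun, algebraMap_embBdRHom_invariantFun,
    Subalgebra.coe_mul, map_mul]

/-- `invariantFun` is additive. [folklore] -/
theorem invariantFun_add (w w' : D2Cris.fixedSubalgebra (D2Cris.galBmaxAlgHom (F := F) (p := p))) :
    invariantFun hp hF (w + w') = invariantFun hp hF w + invariantFun hp hF w' := by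
  rw [invariantFun_eq_iff, map_add, map_add, algebraMap_embBdRHom_invariantFun, algebraMap_embBdRHom_invariantFun,
    Subalgebra.coe_add, map_add]

/-- ★ **The ring homomorphism `B_max(F)^{Γ_F} →+* F`**: `w ↦` the unique `c ∈ F` with the same image as `w` in
`B_dR(F)` (rung Λ4 `invariantToField`, additive and multiplicative). [cite: FontaineAsterisque223III, Exp. III §4.1] -/
def invariantHom : D2Cris.fixedSubalgebra (D2Cris.galBmaxAlgHom (F := F) (p := p)) →+* F where
  toFun := invariantFun hp hF
  map_one' := invariantFun_one hp hF
  map_mul' := invariantFun_mul hp hF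
  map_zero' := invariantFun_zero hp hF
  map_add' := invariantFun_add hp hF

/-- Unfolding of `invariantHom`. [folklore] -/
theorem invariantHom_apply (w : D2Cris.fixedSubalgebra (D2Cris.galBmaxAlgHom (F := F) (p := p))) :
    invariantHom hp hF w = invariantFun hp hF w := rfl

/-- Defining property: `embBdR (invariantHom w) = w` in `B_dR(F)`. [folklore] -/
theorem algebraMap_embBdRHom_invariantHom (w : D2Cris.fixedSubalgebra (D2Cris.galBmaxAlgHom (F := F) (p := p))) :
    algebraMap (BDeRhamPlus (integerC F) p) (FracBdR F p) (embBdRHom hp hF (invariantHom hp hF w)) =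
      bmaxToFracBdR hF (w : D2Cris.Bmax F p) :=
  algebraMap_embBdRHom_invariantFun hp hF w

/-- ★ **`B_max(F)^{Γ_F} →+* F` is injective.** [cite: FontaineAsterisque223III, Exp. III §4.1] -/
theorem invariantHom_injective : Function.Injective (invariantHom hp hF) := fun w w' h =>
  Subtype.ext (invariantToField_injective hp hF (forall_galBmax_coe w) (forall_galBmax_coe w') h)

/-- **Rigidity**: `B_max(F)^{Γ_F} → F` restricted to `ℚ_p ⊆ B_max(F)^{Γ_F}` is THE embedding `ℚ_p → F` (any two ring
maps `ℚ_p → F` agree, tree `LocalField.ringHom_padic_ext`). [cite: SerreLocalFields1979, Ch. II §5] -/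
theorem invariantHom_comp_algebraMap :
    (invariantHom hp hF).comp (algebraMap ℚ_[p] (D2Cris.fixedSubalgebra (D2Cris.galBmaxAlgHom (F := F) (p := p)))) =
      LocalField.padicRingHom F p hp :=
  LocalField.ringHom_padic_ext _ _

/-- ★ **`B_max(F)^{Γ_F} →ₐ[ℚ_p] F`** for the canonical `ℚ_p`-structure `LocalField.padicAlgebra` of `F`: the ring map
`invariantHom` is `ℚ_p`-linear by rigidity. [cite: FontaineAsterisque223III, Exp. III §4.1] [cite: SerreLocalFields1979, Ch. II §5] -/
def invariantAlgHom :
    letI := LocalField.padicAlgebra F p hp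
    D2Cris.fixedSubalgebra (D2Cris.galBmaxAlgHom (F := F) (p := p)) →ₐ[ℚ_[p]] F :=
  letI := LocalField.padicAlgebra F p hp
  { invariantHom hp hF with
    commutes' := fun c => by
      change invariantHom hp hF (algebraMap ℚ_[p] _ c) = LocalField.padicRingHom F p hp c
      exact RingHom.congr_fun (invariantHom_comp_algebraMap hp hF) c }

/-- Unfolding of `invariantAlgHom`. [folklore] -/
theorem invariantAlgHom_apply (w : D2Cris.fixedSubalgebra (D2Cris.galBmaxAlgHom (F := F) (p := p))) :
    (letI := LocalField.padicAlgebra F p hp; invariantAlgHom hp hF w) = invariantHom hp hF w := rfl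

/-- `B_max(F)^{Γ_F} →ₐ[ℚ_p] F` is injective. [folklore] -/
theorem invariantAlgHom_injective :
    letI := LocalField.padicAlgebra F p hp; Function.Injective (invariantAlgHom hp hF) :=
  fun _ _ h => invariantHom_injective hp hF h

/-! ### §2 `B_max(F)^{Γ_F}` is finite-dimensional: `f ≤ dim_{ℚ_p} B_max(F)^{Γ_F} ≤ [F : ℚ_p]` -/

include hp hF in
/-- ★ **`B_max(F)^{Γ_F}` is finite-dimensional over `ℚ_p`** (it embeds `ℚ_p`-linearly in `F`, and `[F : ℚ_p] < ∞`,
tree `PadicBase.instFiniteDimensional`). [cite: FontaineAsterisque223III, Exp. III §1.5] -/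
theorem finite_fixedSubalgebra :
    Module.Finite ℚ_[p] (D2Cris.fixedSubalgebra (D2Cris.galBmaxAlgHom (F := F) (p := p))) := by
  letI := LocalField.padicAlgebra F p hp
  haveI : FiniteDimensional ℚ_[p] F := PadicBase.instFiniteDimensional (F := F) (p := p) hp
  exact FiniteDimensional.of_injective (invariantAlgHom hp hF).toLinearMap (invariantAlgHom_injective hp hF)

include hF in
/-- ★ **`dim_{ℚ_p} B_max(F)^{Γ_F} ≤ [F : ℚ_p]`.** [cite: FontaineAsterisque223III, Exp. III §1.5] -/
theorem finrank_fixedSubalgebra_le :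
    Module.finrank ℚ_[p] (D2Cris.fixedSubalgebra (D2Cris.galBmaxAlgHom (F := F) (p := p))) ≤
      (letI := LocalField.padicAlgebra F p hp; Module.finrank ℚ_[p] F) := by
  letI := LocalField.padicAlgebra F p hp
  haveI : FiniteDimensional ℚ_[p] F := PadicBase.instFiniteDimensional (F := F) (p := p) hp
  exact LinearMap.finrank_le_finrank_of_injective (f := (invariantAlgHom hp hF).toLinearMap)
    (invariantAlgHom_injective hp hF)

end Hom

/-! ### §3 `D_cris(𝟙_m)`: finiteness and `m·f ≤ dim ≤ m·[F:ℚ_p]` -/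

section Main

variable [Fact (¬ IsUnit (p : maxUnramifiedCompletion F))] [CharP (IsLocalRing.ResidueField (maxUnramifiedCompletion F)) p]
  (hp : valuation F p < 1) (hF : Function.Surjective (fontaineTheta (integerC F) p)) {m : ℕ}

include hF in
/-- **`f ≤ dim_{ℚ_p} B_max(F)^{Γ_F} ≤ [F : ℚ_p]`** for `q_F = p^f`, for every `p`-adic field `F` (the true value is
`f = [K₀ : ℚ_p]`; the lower bound is the Teichmüller periods, Λ8a `D2Cris.le_finrank_fixedSubalgebra`).
[cite: FontaineAsterisque223III, Exp. III §1.5] [cite: Colmez1998Annals, §III.2] -/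
theorem le_finrank_fixedSubalgebra_le {f : ℕ} (hq : residueFieldCard F = p ^ f) :
    f ≤ Module.finrank ℚ_[p] (D2Cris.fixedSubalgebra (D2Cris.galBmaxAlgHom (F := F) (p := p))) ∧
      Module.finrank ℚ_[p] (D2Cris.fixedSubalgebra (D2Cris.galBmaxAlgHom (F := F) (p := p))) ≤
        (letI := LocalField.padicAlgebra F p hp; Module.finrank ℚ_[p] F) := by
  haveI := finite_fixedSubalgebra hp hF
  exact ⟨D2Cris.le_finrank_fixedSubalgebra hF hq, finrank_fixedSubalgebra_le hp hF⟩

omit [Fact (¬ IsUnit (p : maxUnramifiedCompletion F))] [CharP (IsLocalRing.ResidueField (maxUnramifiedCompletion F)) p] in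
include hp hF in
/-- ★★ **`D_cris(𝟙_m)` over the constructed `B_max(F)` is finite-dimensional over `ℚ̄_p`, for every `p`-adic field
`F`** (`θ` surjective): the finiteness ASSUMED by the tree's `D2Cris.mul_le_finrank_Dcris_one` holds.
[cite: FontaineAsterisque223III, Exp. III §1.5] -/
theorem finite_Dcris_one :
    Module.Finite (PadicAlgCl p) (D2Cris.Dcris (F := F) (p := p) (1 : FramedRep (absoluteGaloisGroup F) (PadicAlgCl p) m)) := by
  haveI := finite_fixedSubalgebra hp hF
  exact D2Cris.finite_Dcris_one

omit [Fact (¬ IsUnit (p : maxUnramifiedCompletion F))] [CharP (IsLocalRing.ResidueField (maxUnramifiedCompletion F)) p] in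
include hp hF in
/-- ★ **`dim_{ℚ̄_p} D_cris(𝟙_m) = m · dim_{ℚ_p} B_max(F)^{Γ_F}`**, unconditionally. [cite: FontaineAsterisque223III, Exp. III §1.5] -/
theorem finrank_Dcris_one_eq :
    Module.finrank (PadicAlgCl p) (D2Cris.Dcris (F := F) (p := p) (1 : FramedRep (absoluteGaloisGroup F) (PadicAlgCl p) m)) =
      m * Module.finrank ℚ_[p] (D2Cris.fixedSubalgebra (D2Cris.galBmaxAlgHom (F := F) (p := p))) := by
  haveI := finite_fixedSubalgebra hp hF
  exact D2Cris.finrank_Dcris_one_eq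

include hF in
/-- ★★ **`m · f ≤ dim_{ℚ̄_p} D_cris(𝟙_m) ≤ m · [F : ℚ_p]`** for `q_F = p^f`, for every `p`-adic field `F`.
[cite: BuzzardGeeLMS2014, Conj. 3.2.2] [cite: FontaineAsterisque223III, Exp. III §1.5] -/
theorem mul_le_finrank_Dcris_one_le {f : ℕ} (hq : residueFieldCard F = p ^ f) :
    m * f ≤ Module.finrank (PadicAlgCl p)
        (D2Cris.Dcris (F := F) (p := p) (1 : FramedRep (absoluteGaloisGroup F) (PadicAlgCl p) m)) ∧
      Module.finrank (PadicAlgCl p)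
          (D2Cris.Dcris (F := F) (p := p) (1 : FramedRep (absoluteGaloisGroup F) (PadicAlgCl p) m)) ≤
        m * (letI := LocalField.padicAlgebra F p hp; Module.finrank ℚ_[p] F) := by
  haveI := finite_fixedSubalgebra hp hF
  refine ⟨D2Cris.mul_le_finrank_Dcris_one_of_finite hF hq, ?_⟩
  rw [D2Cris.finrank_Dcris_one_eq]
  exact Nat.mul_le_mul_left m (finrank_fixedSubalgebra_le hp hF)

include hF in
/-- ★★ **`dim_{ℚ̄_p} D_cris(𝟙_m) = m · f` under `[F : ℚ_p] = f`** — for absolutely unramified `F` this binder IS the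
degree formula `[F : ℚ_p] = e · f` with `e = 1` (not yet in the tree in this currency): the `𝟙_m` instance of the rank
clause `n · f(v|ℓ)` of `CrystallineCompatibleAt` at an unramified place. [cite: BuzzardGeeLMS2014, Conj. 3.2.2]
[cite: SerreLocalFields1979, Ch. II §5] -/
theorem finrank_Dcris_one_eq_of_finrank_eq {f : ℕ} (hq : residueFieldCard F = p ^ f)
    (hdeg : (letI := LocalField.padicAlgebra F p hp; Module.finrank ℚ_[p] F) = f) :
    Module.finrank (PadicAlgCl p)
        (D2Cris.Dcris (F := F) (p := p) (1 : FramedRep (absoluteGaloisGroup F) (PadicAlgCl p) m)) = m * f := by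
  obtain ⟨h1, h2⟩ := mul_le_finrank_Dcris_one_le (m := m) hp hF hq
  rw [hdeg] at h2
  exact le_antisymm h2 h1

include hF in
/-- **`dim_{ℚ_p} B_max(F)^{Γ_F} = f` under `[F : ℚ_p] = f`** (absolutely unramified `F`: `B_max(F)^{Γ_F} = K₀ = F`).
[cite: Colmez1998Annals, §III.2] -/
theorem finrank_fixedSubalgebra_eq_of_finrank_eq {f : ℕ} (hq : residueFieldCard F = p ^ f)
    (hdeg : (letI := LocalField.padicAlgebra F p hp; Module.finrank ℚ_[p] F) = f) :
    Module.finrank ℚ_[p] (D2Cris.fixedSubalgebra (D2Cris.galBmaxAlgHom (F := F) (p := p))) = f := by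
  obtain ⟨h1, h2⟩ := le_finrank_fixedSubalgebra_le hp hF hq
  rw [hdeg] at h2
  exact le_antisymm h2 h1

end Main

end SpecC

end Summit.Langlands.Langlands.Theorems

end
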